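import Literature.MathematicalPhysics.QuantumFieldTheory.Sweep1ChatterjeeFreeEnergyProofs
import Summits.QuantumFields.YangMills.Theorems.EquipartitionCriticalityFreeEnergyLogCoefficientDefs
import HarnessLib

/-!
# The abstract one-box bounds in free-energy form — crux `FreeEnergyLogCoefficient`, line `Sketch`, stub `abstractJointLimit` (part A)

S. Chatterjee, *The leading term of the Yang–Mills free energy*, J. Funct. Anal. 271 (2016),
arXiv:1602.01222, §17, GROUP-FREE: the two-sided bounds for the free energy per site
`F(B_n, β) = log Z(B_n, β)/n^d` in the normalised form `T(B_n, β) = F(B_n, β) + (|E_n^1|/(2n^d)) D log β`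
compared with the main term `G(n) = (|E_n^1|/n^d) log c_H + D log Z_M(B_n)/n^d`, for an ABSTRACT
one-box interface `B : OneBoxBounds d` (port of the tree file
`Literature/MathematicalPhysics/QuantumFieldTheory/ChatterjeeFreeEnergyBounds.lean`, which is the case
`U(N)`: `D = N²`, `c_H = haarChartConst N`, `A = 67N`, `P₅ = 2N`, `ν = N`, `r₁ = 1/4`).

* `F_nonpos`, `neg_C71_mul_log_le_F`, `abs_F_le`, `abs_T_le`: `-C₇₁ log β ≤ F ≤ 0` (Theorem 7.1).
* `T_le_G_add` (**Lemma 17.2**, F-form), `F_le_mul_F` (**Lemma 17.3**), `mul_F_le_F`, `F_ge_of_ge`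
  (**Lemma 17.5**), `G_sub_le_T`, `G_sub_le_T_small`, `G_sub_le_T_special` (**Lemma 17.6** with the
  union bound resp. Theorem 14.3 supplying the Gaussian small-ball probability).

## References

* S. Chatterjee, *The leading term of the Yang–Mills free energy*, J. Funct. Anal. 271 (2016)
  2944–3005, arXiv:1602.01222, §17 (Lemmas 17.2, 17.3, 17.5, 17.6), Thm. 7.1, Thm. 14.3.
  [arXiv160201222]
-/

noncomputable section

open scoped Matrix Matrix.Norms.Frobenius ENNReal NNReal
open MeasureTheory Measure Filter Topology Set
open Literature.Probability.LatticeModels Literature.MathematicalPhysics.QuantumLattice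
open Literature.MathematicalPhysics.QuantumFieldTheory

namespace Summit.QuantumFields.YangMills.Theorems.FreeEnergyLogCoefficient

namespace OneBoxBounds

open ChatterjeeJointLimit WilsonWeakCoupling LatticeMaxwell ChatterjeeAssembly AxialGauge

variable {d : ℕ} (B : OneBoxBounds d)

/-! ### A priori bounds: `-C₇₁ log β ≤ F(B_n, β) ≤ 0` -/

/-- `F(B_n, β) ≤ 0` for `β ≥ 0`. [cite: arXiv160201222, §17 (`F ≤ 0`)] -/
theorem F_nonpos {β : ℝ} (hβ : 0 ≤ β) (n : ℕ) : B.F n β ≤ 0 :=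
  div_nonpos_of_nonpos_of_nonneg (B.logZ_nonpos n β hβ) (by positivity)

/-- **Theorem 7.1 in F-form**: `F(B_n, β) ≥ -C₇₁ log β` for `β ≥ 2`. [cite: arXiv160201222, Thm. 7.1] -/
theorem neg_C71_mul_log_le_F {β : ℝ} (hβ : 2 ≤ β) (n : ℕ) : -(B.C71 * Real.log β) ≤ B.F n β := by
  have h2 := B.thm71 n β hβ
  have hlog : 0 ≤ Real.log β := Real.log_nonneg (by linarith)
  have hC := B.C71_pos
  unfold OneBoxBounds.F
  rcases (pow_nonneg (Nat.cast_nonneg n) d : (0 : ℝ) ≤ (n : ℝ) ^ d).eq_or_lt with h0 | hpos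
  · rw [← h0, div_zero]; nlinarith
  · rw [le_div_iff₀ hpos]
    have : -(B.C71 * Real.log β) * (n : ℝ) ^ d = -(B.C71 * (n : ℝ) ^ d * Real.log β) := by ring
    linarith

/-- `|F(B_n, β)| ≤ C₇₁ log β` for `β ≥ 2`. [cite: arXiv160201222, Thm. 7.1] -/
theorem abs_F_le {β : ℝ} (hβ : 2 ≤ β) (n : ℕ) : |B.F n β| ≤ B.C71 * Real.log β := by
  rw [abs_le]; exact ⟨B.neg_C71_mul_log_le_F hβ n, (B.F_nonpos (by linarith) n).trans
    (mul_nonneg B.C71_pos.le (Real.log_nonneg (by linarith)))⟩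

/-- `|T(B_n, β)| ≤ K log β = (C₇₁ + d D/2) log β` for `β ≥ 2`. [folklore] -/
theorem abs_T_le {β : ℝ} (hβ : 2 ≤ β) (n : ℕ) : |B.T n β| ≤ B.Kc * Real.log β := by
  have h1 := B.abs_F_le hβ n
  have hlog : 0 ≤ Real.log β := Real.log_nonneg (by linarith)
  have hD : (0 : ℝ) ≤ (B.D : ℝ) := Nat.cast_nonneg _
  have h2 : |coef d n / 2 * (B.D : ℝ) * Real.log β| ≤ d * (B.D : ℝ) / 2 * Real.log β := by
    rw [abs_of_nonneg (by have := coef_nonneg (d := d) n; positivity)]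
    have := coef_le (d := d) n
    have hN : (0 : ℝ) ≤ (B.D : ℝ) * Real.log β := by positivity
    calc coef d n / 2 * (B.D : ℝ) * Real.log β = coef d n / 2 * ((B.D : ℝ) * Real.log β) := by ring
      _ ≤ d / 2 * ((B.D : ℝ) * Real.log β) := by gcongr
      _ = d * (B.D : ℝ) / 2 * Real.log β := by ring
  calc |B.T n β| ≤ |B.F n β| + |coef d n / 2 * (B.D : ℝ) * Real.log β| := abs_add_le _ _
    _ ≤ B.C71 * Real.log β + d * (B.D : ℝ) / 2 * Real.log β := add_le_add h1 h2
    _ = B.Kc * Real.log β := by unfold OneBoxBounds.Kc; ring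

/-! ### Lemma 17.2 in free-energy form -/

/-- **Lemma 17.2 (F-form)**: for `β ≥ 2`, `n ≥ 1` and `ρ₀ ≤ r₁/2`,
`T(B_n, β) ≤ G(n) + log 2/n^d + A β (2ρ₀)³ d²`. [cite: arXiv160201222, Lemma 17.2] -/
theorem T_le_G_add {β : ℝ} (hβ : 2 ≤ β) {n : ℕ} (hn : 1 ≤ n) (hρ : rho0 B.C71 d n β ≤ B.r₁ / 2) :
    B.T n β ≤ B.Gm n + Real.log 2 / (n : ℝ) ^ d +
      B.A * β * (2 * rho0 B.C71 d n β) ^ 3 * ((d : ℝ) * d) := by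
  have h := B.upper n β hn hβ hρ
  have hnd : (0 : ℝ) < (n : ℝ) ^ d := by positivity
  have hPn : (Pn d n : ℝ) ≤ d * d * (n : ℝ) ^ d := by exact_mod_cast card_plaquettesIn_le (d := d) n
  have hA := B.A_nonneg
  set E : ℝ := B.A * β * (2 * rho0 B.C71 d n β) ^ 3 with hE
  have hE0 : 0 ≤ E := by have := rho0_nonneg B.C71 d n β; rw [hE]; positivity
  have hEP : E * Pn d n ≤ E * (d * d * (n : ℝ) ^ d) := mul_le_mul_of_nonneg_left hPn hE0
  have eq1 : B.T n β = (B.logZ n β + D₁ d n / 2 * (B.D : ℝ) * Real.log β) / (n : ℝ) ^ d := by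
    unfold OneBoxBounds.T OneBoxBounds.F; rw [coef]; field_simp
  have eq2 : B.Gm n + Real.log 2 / (n : ℝ) ^ d + E * ((d : ℝ) * d) =
      (D₁ d n * Real.log B.cH + (B.D : ℝ) * logZM d n + Real.log 2 +
        E * (d * d * (n : ℝ) ^ d)) / (n : ℝ) ^ d := by
    unfold OneBoxBounds.Gm; rw [coef]; field_simp
  rw [eq1, eq2]
  refine div_le_div_of_nonneg_right ?_ hnd.le
  linarith

/-! ### Lemma 17.3 in cube form -/

/-- **Lemma 17.3 (cube form)**: for `β ≥ 0`, `1 ≤ m`, `m + 1 ≤ n` and `k = ⌊n/(m+1)⌋`,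
`F(B_n, β) ≤ (km/n)^d F(B_m, β)`. [cite: arXiv160201222, Lemma 17.3] -/
theorem F_le_mul_F {β : ℝ} (hβ : 0 ≤ β) {m n : ℕ} (hm : 1 ≤ m) (hmn : m + 1 ≤ n) :
    B.F n β ≤ (((n / (m + 1) : ℕ) : ℝ) * m / n) ^ d * B.F m β := by
  set k := n / (m + 1) with hk
  have hkn : (m + 1) * k ≤ n := Nat.mul_div_le n (m + 1)
  have h1 : B.logZ n β ≤ B.logZ ((m + 1) * k) β := B.logZ_anti β hβ _ _ hkn
  have h2 : B.logZ ((m + 1) * k) β ≤ (k : ℝ) ^ d * B.logZ m β := B.mul_le β hβ m k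
  have hn1 : 1 ≤ n := by omega
  have hn : (0 : ℝ) < (n : ℝ) ^ d := by positivity
  have hm' : (0 : ℝ) < (m : ℝ) ^ d := by positivity
  unfold OneBoxBounds.F
  calc B.logZ n β / (n : ℝ) ^ d ≤ (k : ℝ) ^ d * B.logZ m β / (n : ℝ) ^ d :=
        div_le_div_of_nonneg_right (h1.trans h2) hn.le
    _ = ((k : ℝ) * m / n) ^ d * (B.logZ m β / (m : ℝ) ^ d) := by
        rw [div_pow, mul_pow]; field_simp

/-! ### Monotonicity in F-form and Lemma 17.5 in cube form -/

/-- `F(B_n, β) ≥ (n'/n)^d F(B_{n'}, β)` for `1 ≤ n ≤ n'`, `β ≥ 0`. [cite: arXiv160201222, Lemma 17.3 (proof)] -/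
theorem mul_F_le_F {β : ℝ} (hβ : 0 ≤ β) {n n' : ℕ} (hn : 1 ≤ n) (h : n ≤ n') :
    ((n' : ℝ) / n) ^ d * B.F n' β ≤ B.F n β := by
  have h1 : B.logZ n' β ≤ B.logZ n β := B.logZ_anti β hβ _ _ h
  have hn0 : (0 : ℝ) < (n : ℝ) ^ d := by positivity
  have hn1' : 1 ≤ n' := hn.trans h
  have hn' : (0 : ℝ) < (n' : ℝ) ^ d := by positivity
  unfold OneBoxBounds.F
  calc ((n' : ℝ) / n) ^ d * (B.logZ n' β / (n' : ℝ) ^ d) = B.logZ n' β / (n : ℝ) ^ d := by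
        rw [div_pow]; field_simp
    _ ≤ B.logZ n β / (n : ℝ) ^ d := div_le_div_of_nonneg_right h1 hn0.le

/-- **Lemma 17.5 (cube form, lower half)**: for `β ≥ 0`, `1 ≤ n''`, `n'' + 1 ≤ n` and
`k = ⌊n/(n''+1)⌋ + 1` (so that `B_n ⊆ B_{(n''+1)k}`),
`F(B_n, β) ≥ (k n''/n)^d F(B_{n''}, β) - βP₅ · #planes · (k/n)^d (2 n''^{d-1} + (n''+1)^d - n''^d)`. [cite: arXiv160201222, Lemma 17.5] -/
theorem F_ge_of_ge {β : ℝ} (hβ : 0 ≤ β) {n'' n : ℕ} (hn'' : 1 ≤ n'') (hn : n'' + 1 ≤ n) :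
    ((((n / (n'' + 1) : ℕ) : ℝ) + 1) * n'' / n) ^ d * B.F n'' β -
        β * B.P₅ * Fintype.card {q : Fin d × Fin d // q.1 < q.2} *
          ((((n / (n'' + 1) : ℕ) : ℝ) + 1) / n) ^ d *
            (2 * (n'' : ℝ) ^ (d - 1) + (((n'' : ℝ) + 1) ^ d - (n'' : ℝ) ^ d)) ≤
      B.F n β := by
  set k := n / (n'' + 1) + 1 with hk
  set D : ℕ := Fintype.card {q : Fin d × Fin d // q.1 < q.2} with hD
  have hnk : n ≤ (n'' + 1) * k := by
    have := Nat.lt_div_mul_add (a := n) (b := n'' + 1) (by omega)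
    rw [hk, Nat.mul_add, mul_one, Nat.mul_comm]; exact this.le
  have h1 : B.logZ ((n'' + 1) * k) β ≤ B.logZ n β := B.logZ_anti β hβ _ _ hnk
  have h2' : (k : ℝ) ^ d * (B.logZ n'' β - β * B.P₅ * (2 * D * (n'' : ℝ) ^ (d - 1))) -
      β * B.P₅ * (D * ((k : ℝ) ^ d * (((n'' + 1 : ℕ) : ℝ) ^ d - (n'' : ℝ) ^ d))) ≤
        B.logZ ((n'' + 1) * k) β := B.le_mul β hβ n'' k
  have hn1 : 1 ≤ n := by omega
  have hn0 : (0 : ℝ) < (n : ℝ) ^ d := by positivity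
  have hn''0 : (0 : ℝ) < (n'' : ℝ) ^ d := by positivity
  unfold OneBoxBounds.F
  have hkey : (k : ℝ) ^ d * B.logZ n'' β -
      β * B.P₅ * D * (k : ℝ) ^ d * (2 * (n'' : ℝ) ^ (d - 1) + (((n'' : ℝ) + 1) ^ d - (n'' : ℝ) ^ d)) ≤
        B.logZ n β := by
    have : (((n'' + 1 : ℕ) : ℝ)) = (n'' : ℝ) + 1 := by push_cast; ring
    rw [this] at h2'
    linarith
  have eq : (((k : ℝ)) * n'' / n) ^ d * (B.logZ n'' β / (n'' : ℝ) ^ d) -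
      β * B.P₅ * D * ((k : ℝ) / n) ^ d * (2 * (n'' : ℝ) ^ (d - 1) + (((n'' : ℝ) + 1) ^ d - (n'' : ℝ) ^ d)) =
      ((k : ℝ) ^ d * B.logZ n'' β -
        β * B.P₅ * D * (k : ℝ) ^ d * (2 * (n'' : ℝ) ^ (d - 1) + (((n'' : ℝ) + 1) ^ d - (n'' : ℝ) ^ d))) /
        (n : ℝ) ^ d := by
    rw [div_pow, div_pow, mul_pow]; field_simp
  have hk' : ((((n / (n'' + 1) : ℕ) : ℝ) + 1)) = (k : ℝ) := by rw [hk]; push_cast; ring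
  rw [hk', eq]
  exact div_le_div_of_nonneg_right hkey hn0.le

/-! ### Lemma 17.6 in free-energy form -/

/-- **The Gaussian lower bound in F-form** (core of Lemma 17.6): for `β ≥ 2`, `n ≥ 1`,
`0 < r ≤ r₁` and `0 < L ≤ τ_n(|y_e| ≤ √β r/ν ∀ e)`,
`T(B_n, β) ≥ G(n) - (coef(n) D log κ(r) + A β r³ d² - D log L / n^d)`. [cite: arXiv160201222, Lemma 17.6] -/
theorem G_sub_le_T {β : ℝ} (hβ : 2 ≤ β) {n : ℕ} (hn : 1 ≤ n) {r : ℝ} (hr : 0 < r)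
    (hr2 : r ≤ B.r₁) {L : ℝ≥0∞} (hL0 : L ≠ 0)
    (hL : L ≤ τ (pinI (d := d)) (0 : Site d) n {y | ∀ e, |y e| ≤ Real.sqrt β * r / B.ν}) :
    B.Gm n - (coef d n * (B.D : ℝ) * Real.log (B.κ r) + B.A * β * r ^ 3 * ((d : ℝ) * d) -
        (B.D : ℝ) * (Real.log L.toReal / (n : ℝ) ^ d)) ≤ B.T n β := by
  have h := B.lower n β hn hβ r hr hr2 L hL0 hL
  have hnd : (0 : ℝ) < (n : ℝ) ^ d := by positivity
  have hPn : (Pn d n : ℝ) ≤ d * d * (n : ℝ) ^ d := by exact_mod_cast card_plaquettesIn_le (d := d) n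
  have hβ0 : 0 ≤ β := by linarith
  have hA := B.A_nonneg
  set E : ℝ := B.A * β * r ^ 3 with hE
  have hE0 : 0 ≤ E := by rw [hE]; positivity
  have hEP : E * Pn d n ≤ E * (d * d * (n : ℝ) ^ d) := mul_le_mul_of_nonneg_left hPn hE0
  have eq1 : B.T n β = (B.logZ n β + D₁ d n / 2 * (B.D : ℝ) * Real.log β) / (n : ℝ) ^ d := by
    unfold OneBoxBounds.T OneBoxBounds.F; rw [coef]; field_simp
  have eq2 : B.Gm n - (coef d n * (B.D : ℝ) * Real.log (B.κ r) + E * ((d : ℝ) * d) -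
      (B.D : ℝ) * (Real.log L.toReal / (n : ℝ) ^ d)) =
      (D₁ d n * Real.log B.cH + (B.D : ℝ) * logZM d n -
        (D₁ d n * (B.D : ℝ) * Real.log (B.κ r) + E * (d * d * (n : ℝ) ^ d) -
          (B.D : ℝ) * Real.log L.toReal)) / (n : ℝ) ^ d := by
    unfold OneBoxBounds.Gm; rw [coef]; field_simp
  rw [eq1, eq2]
  refine div_le_div_of_nonneg_right ?_ hnd.le
  linarith

/-- **Lower bound, small `n`**: for `β ≥ 2`, `n ≥ 1`, `0 < r ≤ r₁` and `R_z(n) ≤ √β r/ν`,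
`T(B_n, β) ≥ G(n) - (coef(n) D log κ(r) + A β r³ d² + D log 2 / n^d)`. [cite: arXiv160201222, Lemma 17.6] -/
theorem G_sub_le_T_small {β : ℝ} (hβ : 2 ≤ β) {n : ℕ} (hn : 1 ≤ n) {r : ℝ} (hr : 0 < r)
    (hr2 : r ≤ B.r₁) (hx : Rz d n ≤ Real.sqrt β * r / B.ν) :
    B.Gm n - (coef d n * (B.D : ℝ) * Real.log (B.κ r) + B.A * β * r ^ 3 * ((d : ℝ) * d) +
        (B.D : ℝ) * (Real.log 2 / (n : ℝ) ^ d)) ≤ B.T n β := by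
  have h := B.G_sub_le_T hβ hn hr hr2 (L := 1 / 2) (by norm_num) (half_le_τ hx)
  have hlog : Real.log ((1 / 2 : ℝ≥0∞)).toReal = -Real.log 2 := by
    rw [ENNReal.toReal_div, ENNReal.toReal_one, ENNReal.toReal_ofNat, one_div, Real.log_inv]
  rw [hlog] at h
  have : -((B.D : ℝ) * (-Real.log 2 / (n : ℝ) ^ d)) = (B.D : ℝ) * (Real.log 2 / (n : ℝ) ^ d) := by ring
  linarith

/-- **Lower bound, special `n = ρ(m-1)+1`** (Lemma 17.6 with Theorem 14.3 supplying the Gaussian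
small-ball probability): for `β ≥ 2`, `d ≥ 1`, `m ≥ 2`, `ρ ≥ 1`, `0 < r ≤ r₁`, and with
`η = n^{-d}` satisfying `η ≤ √β r/ν`, `R₀(m, η) ≤ √β r/ν`,
`T(B_n, β) ≥ G(n) - (coef(n) D log κ(r) + Aβr³d² + D (log 2/(m-1)^d + (4d²/(m-1)) B(n)))`. [cite: arXiv160201222, Lemma 17.6, Thm. 14.3] -/
theorem G_sub_le_T_special {β : ℝ} (hβ : 2 ≤ β) (hd : 1 ≤ d) {m ρ : ℕ} (hm : 2 ≤ m)
    (hρ : 1 ≤ ρ) {r : ℝ} (hr : 0 < r) (hr2 : r ≤ B.r₁)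
    (hη : ((fineN m ρ : ℝ) ^ d)⁻¹ ≤ Real.sqrt β * r / B.ν)
    (hR : R0 d m (((fineN m ρ : ℝ) ^ d)⁻¹) ≤ Real.sqrt β * r / B.ν) :
    B.Gm (fineN m ρ) - (coef d (fineN m ρ) * (B.D : ℝ) * Real.log (B.κ r) +
        B.A * β * r ^ 3 * ((d : ℝ) * d) +
        (B.D : ℝ) * (Real.log 2 / ((m : ℝ) - 1) ^ d +
          4 * (d : ℝ) ^ 2 / ((m : ℝ) - 1) * Bcost d (fineN m ρ))) ≤
      B.T (fineN m ρ) β := by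
  set n := fineN m ρ with hn
  have hn1 : 1 ≤ n := by rw [hn, fineN]; omega
  have hn0 : (0 : ℝ) < n := by exact_mod_cast hn1
  have hnd : (0 : ℝ) < (n : ℝ) ^ d := by positivity
  set η : ℝ := ((n : ℝ) ^ d)⁻¹ with hηdef
  have hη0 : 0 < η := inv_pos.2 hnd
  set R' : ℝ := Real.sqrt β * r / B.ν with hR'
  -- Theorem 14.3
  have h143 := theorem_14_3 (d := d) (m := m) (r := ρ) hm hη0 hη hR (fun b _ => Rθ_le_R0 b η)
  set base : ℝ := 2 * η * (Real.sqrt (cLow d n) / Real.sqrt (2 * Real.pi)) *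
    Real.exp (-(cUp d n * η ^ 2 / 2)) with hbase
  have hbase0 : 0 < base := by
    rw [hbase]; have := cLow_pos (d := d) (n := n); positivity
  set A : ℕ := (Abdry (d := d) m ρ).card with hA
  set L : ℝ≥0∞ := (2 ^ (ρ ^ d))⁻¹ * ENNReal.ofReal (base ^ A) with hL
  have h2ne0 : (2 : ℝ≥0∞) ^ (ρ ^ d) ≠ 0 := pow_ne_zero _ two_ne_zero
  have h2netop : (2 : ℝ≥0∞) ^ (ρ ^ d) ≠ ∞ := ENNReal.pow_ne_top ENNReal.ofNat_ne_top
  have hLle : L ≤ τ (pinI (d := d)) (0 : Site d) n {y | ∀ e, |y e| ≤ R'} := by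
    rw [hL, ENNReal.inv_mul_le_iff h2ne0 h2netop]
    exact h143
  have hL0 : L ≠ 0 := by
    rw [hL]; refine mul_ne_zero (ENNReal.inv_ne_zero.2 h2netop) ?_
    rw [ne_eq, ENNReal.ofReal_eq_zero, not_le]; positivity
  have hmain := B.G_sub_le_T hβ hn1 hr hr2 hL0 hLle
  -- `log L.toReal = -ρ^d log 2 + A log base`
  have hLreal : L.toReal = ((2 : ℝ) ^ (ρ ^ d))⁻¹ * base ^ A := by
    rw [hL, ENNReal.toReal_mul, ENNReal.toReal_inv, ENNReal.toReal_pow, ENNReal.toReal_ofNat,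
      ENNReal.toReal_ofReal (by positivity)]
  have hlogL : Real.log L.toReal = -(ρ ^ d * Real.log 2) + A * Real.log base := by
    rw [hLreal, Real.log_mul (by positivity) (by positivity), Real.log_inv, Real.log_pow,
      Real.log_pow]; push_cast; ring
  -- the cost bound
  have hB := neg_Bcost_le_log_base (d := d) hd hn1
  have hB0 := Bcost_nonneg (d := d) hd hn1
  have hm1 : (0 : ℝ) < (m : ℝ) - 1 := by
    have : (2 : ℝ) ≤ m := by exact_mod_cast hm
    linarith
  have hAle : (A : ℝ) ≤ 4 * (d : ℝ) ^ 2 * (n : ℝ) ^ d / ((m : ℝ) - 1) := card_Abdry_le_real hm hρ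
  have hρn : (ρ : ℝ) * ((m : ℝ) - 1) ≤ n := by
    have : (n : ℝ) = ρ * ((m : ℝ) - 1) + 1 := by
      rw [hn, fineN]; push_cast; rw [Nat.cast_sub (by omega)]; push_cast; ring
    linarith
  have hρd : (ρ : ℝ) ^ d * ((m : ℝ) - 1) ^ d ≤ (n : ℝ) ^ d := by
    rw [← mul_pow]; exact pow_le_pow_left₀ (by positivity) hρn d
  -- `-log L/n^d ≤ log 2/(m-1)^d + 4d² B/(m-1)`
  have hkey : -(Real.log L.toReal / (n : ℝ) ^ d) ≤
      Real.log 2 / ((m : ℝ) - 1) ^ d + 4 * (d : ℝ) ^ 2 / ((m : ℝ) - 1) * Bcost d n := by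
    rw [hlogL]
    have hlog2 : 0 ≤ Real.log 2 := Real.log_nonneg one_le_two
    have t1 : (ρ : ℝ) ^ d * Real.log 2 / (n : ℝ) ^ d ≤ Real.log 2 / ((m : ℝ) - 1) ^ d := by
      rw [div_le_div_iff₀ hnd (by positivity)]
      nlinarith
    have t2 : -((A : ℝ) * Real.log base) / (n : ℝ) ^ d ≤
        4 * (d : ℝ) ^ 2 / ((m : ℝ) - 1) * Bcost d n := by
      have hA0 : (0 : ℝ) ≤ (A : ℝ) := Nat.cast_nonneg A
      have hAB : -((A : ℝ) * Real.log base) ≤ A * Bcost d n := by nlinarith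
      calc -((A : ℝ) * Real.log base) / (n : ℝ) ^ d ≤ A * Bcost d n / (n : ℝ) ^ d :=
            div_le_div_of_nonneg_right hAB hnd.le
        _ ≤ (4 * (d : ℝ) ^ 2 * (n : ℝ) ^ d / ((m : ℝ) - 1)) * Bcost d n / (n : ℝ) ^ d := by
            gcongr
        _ = 4 * (d : ℝ) ^ 2 / ((m : ℝ) - 1) * Bcost d n := by field_simp
    have : -((-(↑ρ ^ d * Real.log 2) + ↑A * Real.log base) / (n : ℝ) ^ d) =
        (ρ : ℝ) ^ d * Real.log 2 / (n : ℝ) ^ d + -((A : ℝ) * Real.log base) / (n : ℝ) ^ d := by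
      ring
    rw [this]; exact add_le_add t1 t2
  have hN2 : (0 : ℝ) ≤ (B.D : ℝ) := Nat.cast_nonneg _
  have hfin := mul_le_mul_of_nonneg_left hkey hN2
  linarith only [hmain, hfin]

end OneBoxBounds

end Summit.QuantumFields.YangMills.Theorems.FreeEnergyLogCoefficient

end
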